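import Summits.AtomisticToContinuum.FouriersLaw.Theorems.OddSectorIrreversibilityCorrectorTheoryLeakPointwise

/-!
# `CorrectorTheory` (stmt-AtomisticToContinuum-14071), part 7d′: the leak identity at a fixed time

Helper file for support item `stmt-AtomisticToContinuum-14071`
(`OddSectorIrreversibility.CorrectorTheory`, conjunct A (7)).

Setting: `P = pinnedChain ω₂ lam β γ` (`ω₂, lam > 0`, `β ≥ 0`, `γ > 0`), `T > 0`, `ρ = e^{-H/T}`, a
smooth `u` with `u, k ∈ L²(μ_T)`, `k` ODD in the momenta, `L_{T,T} u = -k` pointwise;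
`u⁻ = (u - u∘Θ)/2`, `u⁺ = (u + u∘Θ)/2`; the closed flow `Φ_s` and `g_s = j_i ∘ Φ_s`.

* `hamiltonian_detFlow'`, `hamiltonian_detFlow_all` — `H ∘ Φ_s = H` (any friction label, any `s`);
* `memLp_currentFlow`, `memLp_two_of_abs_le_cube`, `memLp_liouvilleOp_currentFlow` —
  `g_s, (X_H j_i) ∘ Φ_s ∈ L²(μ_T)`;
* `leak_pointwise` — **for every `s ≥ 0`:
  `∫ u⁻ · (X_H j_i)(Φ_s ·) ρ dx = -γ T ∑_b ([b=0]+[b=N-1]) ∫ ∂_{p_b} u⁺ · ∂_{p_b} g_s ρ dx`**: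
  antisymmetry of `X_H` and the Ornstein–Uhlenbeck Dirichlet form at cutoff level `n`
  (`integral_chi_liouville_antisymm`, `integral_chi_mul_bathOp`), `X_H u⁻ = -γ S u⁺`
  (`liouvilleOp_oddPart`), `X_H g_s = (X_H j_i) ∘ Φ_s`, and `n → ∞` with the square-integrability of
  the tangent map (part 7c).

References: Kundu–Dhar–Narayan 2009 (reln2)–(reln3); folklore. Nothing here closes the item.
-/

noncomputable section

open MeasureTheory Filter Topology Set Function Metric
open scoped ContDiff NNReal ENNReal
open Literature.MathematicalPhysics.KineticTheory.HeatConduction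
open Literature.MathematicalPhysics.KineticTheory
open Summit.AtomisticToContinuum.FouriersLaw.Theorems.ClosedConeSensitivity.Negative.ZeroFrictionDictionary
open Summit.AtomisticToContinuum.FouriersLaw.Theorems.ClosedConeSensitivity.Negative.TangentReduction
open Summit.AtomisticToContinuum.FouriersLaw.Theorems.SuperadditiveResistance.DeviceLiouville
open Summit.AtomisticToContinuum.FouriersLaw.Theorems.SuperadditiveResistance.Kubo
open Summit.AtomisticToContinuum.FouriersLaw.Theorems.LightConeBondHeat
open Summit.AtomisticToContinuum.FouriersLaw.Theorems.SubBallisticWindow.StaticCurrentBound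
open Summit.AtomisticToContinuum.FouriersLaw.Cruxes.SuperadditiveResistance.FloatingProbeBypassLaplacian
open Summit.AtomisticToContinuum.FouriersLaw.Theorems.SubdiffusiveBondHeat

namespace Summit.AtomisticToContinuum.FouriersLaw.Theorems.OddSectorIrreversibility.Corrector

variable {N : ℕ}

/-! ### `L²` bounds along the closed flow -/

section Leak

variable {ω₂ lam β γ : ℝ} (hω : 0 < ω₂) (hl : 0 < lam) (hβ : 0 ≤ β) (hγ : 0 < γ) {T : ℝ} (hT : 0 < T)
include hω hl hβ

/-- Energy conservation along `Φ_s`, for the Hamiltonian of the chain with any friction constant. [folklore] -/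
theorem hamiltonian_detFlow' (γ : ℝ) (N : ℕ) {s : ℝ} (hs : 0 ≤ s) (x : PhaseSpace N) :
    (pinnedChain ω₂ lam β γ).hamiltonian N (detFlow ω₂ lam β N s x) = (pinnedChain ω₂ lam β γ).hamiltonian N x := by
  rw [hamiltonian_indep_friction]
  exact hamiltonian_detFlow hω hl.le hβ N hs x

/-- Energy conservation along `Φ_s` for every real `s` (`Φ_s = id` for `s ≤ 0`). [folklore] -/
theorem hamiltonian_detFlow_all (γ : ℝ) (N : ℕ) (s : ℝ) (x : PhaseSpace N) :
    (pinnedChain ω₂ lam β γ).hamiltonian N (detFlow ω₂ lam β N s x) = (pinnedChain ω₂ lam β γ).hamiltonian N x := by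
  rcases le_or_gt 0 s with hs | hs
  · exact hamiltonian_detFlow' hω hl hβ γ N hs x
  · rw [detFlow_of_nonpos N hs.le x]

include hT

/-- `g_s = j_i ∘ Φ_s ∈ L²(μ_T)` (`|j_i| ≲ e^{ϑH}` and `H ∘ Φ_s = H`). [folklore] -/
theorem memLp_currentFlow (γ : ℝ) (N : ℕ) (i : Fin N) {s : ℝ} (hs : 0 ≤ s) :
    MemLp (fun x => (pinnedChain ω₂ lam β γ).bondCurrent N i (detFlow ω₂ lam β N s x)) 2
      ((pinnedChain ω₂ lam β γ).gibbsMeasure N T) := by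
  have hϑ : 0 < 1 / (4 * T) := by positivity
  have h2ϑ : 2 * (1 / (4 * T)) < 1 / T := by
    rw [show 2 * (1 / (4 * T)) = 1 / (2 * T) by field_simp; ring, div_lt_div_iff₀ (by positivity) hT]
    nlinarith
  refine memLp_two_of_abs_le_exp hω hl.le hβ hT γ
    ((pinnedChain_continuous_bondCurrent ω₂ lam β γ N i).comp (continuous_detFlow hω hl.le hβ N s)) h2ϑ
    (C := N * ((3 + β) / 2) * (2 * Real.exp (1 / (4 * T)) / (1 / (4 * T)) ^ 2)) fun y => ?_
  have h := pinnedChain_abs_bondCurrent_le_exp hω.le hl.le hβ γ N hϑ i (detFlow ω₂ lam β N s y)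
  rwa [hamiltonian_detFlow' hω hl hβ γ N hs] at h

/-- A continuous `f` with `|f| ≤ C (1 + H)³` is in `L²(μ_T)`. [folklore] -/
theorem memLp_two_of_abs_le_cube (γ : ℝ) (N : ℕ) {f : PhaseSpace N → ℝ} (hf : Continuous f) {C : ℝ} (hC0 : 0 ≤ C)
    (hC : ∀ y, |f y| ≤ C * (1 + (pinnedChain ω₂ lam β γ).hamiltonian N y) ^ 3) :
    MemLp f 2 ((pinnedChain ω₂ lam β γ).gibbsMeasure N T) := by
  set P := pinnedChain ω₂ lam β γ with hP
  set ϑ : ℝ := 1 / (16 * T) with hϑd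
  have hϑ : 0 < ϑ := by positivity
  have h2ϑ : 2 * (2 * ϑ) < 1 / T := by
    rw [hϑd, show 2 * (2 * (1 / (16 * T))) = 1 / (4 * T) by field_simp; ring,
      div_lt_div_iff₀ (by positivity) hT]
    nlinarith
  have hU0 : ∀ q, 0 ≤ P.U q := fun q => by show 0 ≤ ω₂ * q ^ 2 / 2 + lam * q ^ 4 / 4; positivity
  have hV0 : ∀ r, 0 ≤ P.V r := fun r => by show 0 ≤ r ^ 2 / 2 + β * r ^ 4 / 4; positivity
  refine memLp_two_of_abs_le_exp hω hl.le hβ hT γ hf h2ϑ (C := C * (2 * Real.exp ϑ / ϑ ^ 2) ^ 2)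
    fun y => ?_
  have hH0 : 0 ≤ P.hamiltonian N y := P.hamiltonian_nonneg_of_nonneg hU0 hV0 N y
  have hsq := one_add_sq_le_exp hH0 hϑ
  have h1 : 1 ≤ 1 + P.hamiltonian N y := by linarith
  calc |f y| ≤ C * (1 + P.hamiltonian N y) ^ 3 := hC y
    _ ≤ C * (1 + P.hamiltonian N y) ^ 4 :=
        mul_le_mul_of_nonneg_left (pow_le_pow_right₀ h1 (by norm_num)) hC0
    _ = C * ((1 + P.hamiltonian N y) ^ 2) ^ 2 := by ring
    _ ≤ C * (2 * Real.exp ϑ / ϑ ^ 2 * Real.exp (ϑ * P.hamiltonian N y)) ^ 2 :=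
        mul_le_mul_of_nonneg_left (pow_le_pow_left₀ (by positivity) hsq 2) hC0
    _ = C * (2 * Real.exp ϑ / ϑ ^ 2) ^ 2 * Real.exp (2 * ϑ * P.hamiltonian N y) := by
        rw [mul_pow, pow_two (Real.exp _), ← Real.exp_add]; ring_nf

/-- `(X_H j_i) ∘ Φ_s ∈ L²(μ_T)` for every real `s` (`|X_H j_i| ≤ C(1+H)³` and `H ∘ Φ_s = H`;
for `s ≤ 0`, `Φ_s = id`). [folklore] -/
theorem memLp_liouvilleOp_currentFlow (γ : ℝ) (N : ℕ) (i : Fin N) (s : ℝ) :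
    MemLp (fun x => liouvilleOp (pinnedChain ω₂ lam β γ) N
        (fun y => (pinnedChain ω₂ lam β γ).bondCurrent N i y) (detFlow ω₂ lam β N s x)) 2
      ((pinnedChain ω₂ lam β γ).gibbsMeasure N T) := by
  set P := pinnedChain ω₂ lam β γ with hP
  obtain ⟨C, hC0, hC⟩ := exists_abs_liouvilleOp_bondCurrent_le hω hl.le hβ γ N i
  have hU1 : ContDiff ℝ 1 P.U := pinnedChain_contDiff_U ω₂ lam β γ
  have hV1 : ContDiff ℝ 1 P.V := pinnedChain_contDiff_V ω₂ lam β γ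
  have hj1 : ContDiff ℝ 1 fun y => P.bondCurrent N i y :=
    (contDiff_bondCurrent _ (pinnedChain_contDiff_V ω₂ lam β γ) N i).of_le (by norm_cast)
  have hcont : Continuous fun x => liouvilleOp P N (fun y => P.bondCurrent N i y) (detFlow ω₂ lam β N s x) :=
    (continuous_liouvilleOp (P := P) hU1 hV1 hj1).comp (continuous_detFlow hω hl.le hβ N s)
  refine memLp_two_of_abs_le_cube hω hl hβ hT γ N hcont hC0 fun y => ?_
  have hy := hC (detFlow ω₂ lam β N s y)
  rwa [hamiltonian_detFlow_all hω hl hβ γ N s] at hy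

include hγ

/-- **The leak identity at a fixed time `s ≥ 0`.** For a smooth `u ∈ L²(μ_T)` with `L u = -k`
(`k ∈ L²(μ_T)` odd) and `g_s = j_i ∘ Φ_s`:
`∫ u⁻ · (X_H j_i)(Φ_s x) ρ dx = -γ T ∑_b B_b ∫ ∂_{p_b} u⁺ ∂_{p_b} g_s ρ dx` (`B` the bath weights).
Proof: at cutoff level `n`, `∫ χ_n (u⁻ X_H g_s + g_s X_H u⁻) ρ = 0`, `X_H u⁻ = -γ S_B u⁺`,
`X_H g_s = (X_H j_i) ∘ Φ_s`, and the cutoff Dirichlet form; then `n → ∞`. [folklore] -/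
theorem leak_pointwise (N : ℕ) {u k : PhaseSpace N → ℝ} (hu : ContDiff ℝ ∞ u)
    (hu2 : MemLp u 2 ((pinnedChain ω₂ lam β γ).gibbsMeasure N T))
    (hk2 : MemLp k 2 ((pinnedChain ω₂ lam β γ).gibbsMeasure N T))
    (hkodd : ∀ x : PhaseSpace N, k (x.1, -x.2) = -k x)
    (hpde : ∀ x, (pinnedChain ω₂ lam β γ).generator N T T u x = -k x) (i : Fin N) {s : ℝ} (hs : 0 ≤ s) :
    ∫ x, (u x - u (x.1, -x.2)) / 2 *
        liouvilleOp (pinnedChain ω₂ lam β γ) N (fun y => (pinnedChain ω₂ lam β γ).bondCurrent N i y)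
          (detFlow ω₂ lam β N s x) * (pinnedChain ω₂ lam β γ).gibbsDensity N T x =
      -(γ * T) * ∑ b : Fin N, OscillatorChain.bathWeight N b *
        ∫ x, partialP b (fun y : PhaseSpace N => (u y + u (y.1, -y.2)) / 2) x *
          partialP b (fun y : PhaseSpace N => (pinnedChain ω₂ lam β γ).bondCurrent N i (detFlow ω₂ lam β N s y)) x *
            (pinnedChain ω₂ lam β γ).gibbsDensity N T x := by
  set P := pinnedChain ω₂ lam β γ with hP
  set B := OscillatorChain.bathWeight N with hB
  set ρ := P.gibbsDensity N T with hρ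
  set uo : PhaseSpace N → ℝ := fun y => (u y - u (y.1, -y.2)) / 2 with huo
  set ue : PhaseSpace N → ℝ := fun y => (u y + u (y.1, -y.2)) / 2 with hue
  set g : PhaseSpace N → ℝ := fun y => P.bondCurrent N i (detFlow ω₂ lam β N s y) with hg
  set Xg : PhaseSpace N → ℝ := fun x => liouvilleOp P N (fun y => P.bondCurrent N i y) (detFlow ω₂ lam β N s x)
    with hXg
  -- smoothness
  have huos : ContDiff ℝ ∞ uo := contDiff_oddPart hu
  have hues : ContDiff ℝ ∞ ue := contDiff_evenPart hu
  have hgs : ContDiff ℝ ∞ g := contDiff_currentFlow hω hl hβ γ N i hs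
  have hj1 : ContDiff ℝ 1 fun y => P.bondCurrent N i y :=
    (contDiff_bondCurrent _ (pinnedChain_contDiff_V ω₂ lam β γ) N i).of_le (by norm_cast)
  have hU1 : ContDiff ℝ 1 P.U := pinnedChain_contDiff_U ω₂ lam β γ
  have hV1 : ContDiff ℝ 1 P.V := pinnedChain_contDiff_V ω₂ lam β γ
  have hXgL : ∀ x, liouvilleOp P N g x = Xg x := fun x => liouvilleOp_comp_detFlow hω hl.le hβ γ N hj1 hs x
  have hXuo : ∀ x, liouvilleOp P N uo x = -γ * bathOp N B T ue x := fun x => by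
    have := liouvilleOp_oddPart P T (hu.of_le (by norm_cast)) hkodd hpde x
    simpa only [huo, hue, show P.γ = γ from rfl] using this
  -- continuity / measurability
  have hρc : Continuous ρ := pinnedChain_continuous_gibbsDensity ω₂ lam β γ N T
  have huoc : Continuous uo := huos.continuous
  have hgc : Continuous g := hgs.continuous
  have hXgc : Continuous Xg := (continuous_liouvilleOp (P := P) hU1 hV1 hj1).comp (continuous_detFlow hω hl.le hβ N s)
  have hSuec : Continuous (bathOp N B T ue) := continuous_bathOp (hues.of_le (by norm_cast)) B T
  have hduec : ∀ b, Continuous (partialP b ue) := fun b => continuous_partialP (hues.of_le (by norm_cast)) one_ne_zero b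
  have hdgc : ∀ b, Continuous (partialP b g) := fun b => continuous_partialP (hgs.of_le (by norm_cast)) one_ne_zero b
  -- L² memberships
  have huo2 : MemLp uo 2 (P.gibbsMeasure N T) := memLp_oddPart hu2
  have hg2 : MemLp g 2 (P.gibbsMeasure N T) := memLp_currentFlow hω hl hβ hT γ N i hs
  have hXg2 : MemLp Xg 2 (P.gibbsMeasure N T) := memLp_liouvilleOp_currentFlow hω hl hβ hT γ N i s
  have hdg2 : ∀ b, MemLp (partialP b g) 2 (P.gibbsMeasure N T) := fun b =>
    memLp_partialP_currentFlow hω hl hβ γ N i b hs hT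
  have hdue2 : ∀ b, 0 < B b → MemLp (partialP b ue) 2 (P.gibbsMeasure N T) := fun b hb =>
    memLp_partialP_evenPart hω hl.le hβ hγ hT hu hu2 hk2 hpde hb
  -- the level-`n` identity
  have hlevel : ∀ n : ℕ, ∫ x, chi P N n x * (uo x * Xg x) * ρ x =
      -(γ * T) * ∑ b, B b * ((∫ x, chi P N n x * partialP b g x * partialP b ue x * ρ x) +
        ∫ x, g x * partialP b (chi P N n) x * partialP b ue x * ρ x) := by
    intro n
    have hχc : Continuous (chi P N n) := (contDiff_chi ((P).contDiff_hamiltonian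
      (pinnedChain_contDiff_U ω₂ lam β γ) (pinnedChain_contDiff_V ω₂ lam β γ) N) n).continuous
    have hχK : HasCompactSupport (chi P N n) := hasCompactSupport_chi hω hl.le hβ γ N n
    have hA := integral_chi_liouville_antisymm hω hl.le hβ γ N hT.ne' (huos.of_le (by norm_cast))
      (hgs.of_le (by norm_cast)) n
    have hD := integral_chi_mul_bathOp hω hl.le hβ γ N B hT.ne' (hgs.of_le (by norm_cast))
      (hues.of_le (by norm_cast)) n
    -- split the antisymmetry integral
    have hI1 : Integrable fun x => chi P N n x * (uo x * Xg x) * ρ x :=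
      Continuous.integrable_of_hasCompactSupport (by fun_prop) ((hχK.mul_right).mul_right)
    have hI2 : Integrable fun x => chi P N n x * g x * bathOp N B T ue x * ρ x :=
      Continuous.integrable_of_hasCompactSupport (by fun_prop) (((hχK.mul_right).mul_right).mul_right)
    have hsplit : ∫ x, chi P N n x * (uo x * liouvilleOp P N g x + g x * liouvilleOp P N uo x) * ρ x =
        (∫ x, chi P N n x * (uo x * Xg x) * ρ x) - γ * ∫ x, chi P N n x * g x * bathOp N B T ue x * ρ x := by
      rw [← integral_const_mul, ← integral_sub hI1 (hI2.const_mul _)]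
      refine integral_congr_ae (Eventually.of_forall fun x => ?_)
      simp only [hXgL x, hXuo x]; ring
    rw [hsplit, hD] at hA
    linarith
  -- limits of both sides
  have hLHS : Tendsto (fun n : ℕ => ∫ x, chi P N n x * (uo x * Xg x) * ρ x) atTop
      (𝓝 (∫ x, uo x * Xg x * ρ x)) := by
    have h := tendsto_integral_chi_mul hω.le hl.le hβ γ N T (F := fun x => uo x * Xg x)
      (by fun_prop : Continuous fun x => uo x * Xg x).aestronglyMeasurable
      (integrable_mul_mul_gibbsDensity hω hl.le hβ γ N hT huo2 hXg2)
    exact h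
  have hRHS : Tendsto (fun n : ℕ => -(γ * T) * ∑ b, B b *
      ((∫ x, chi P N n x * partialP b g x * partialP b ue x * ρ x) +
        ∫ x, g x * partialP b (chi P N n) x * partialP b ue x * ρ x)) atTop
      (𝓝 (-(γ * T) * ∑ b, B b * ∫ x, partialP b ue x * partialP b g x * ρ x)) := by
    refine Tendsto.const_mul _ (tendsto_finsetSum _ fun b _ => ?_)
    by_cases hb : B b = 0
    · simp only [hb, zero_mul]; exact tendsto_const_nhds
    have hb' : 0 < B b := lt_of_le_of_ne (bathWeight_nonneg N b) (Ne.symm hb)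
    refine Tendsto.const_mul _ ?_
    rw [← add_zero (∫ x, partialP b ue x * partialP b g x * ρ x)]
    refine Tendsto.add ?_ ?_
    · have h := tendsto_integral_chi_mul hω.le hl.le hβ γ N T (F := fun x => partialP b g x * partialP b ue x)
        (by fun_prop : Continuous fun x => partialP b g x * partialP b ue x).aestronglyMeasurable
        (integrable_mul_mul_gibbsDensity hω hl.le hβ γ N hT (hdg2 b) (hdue2 b hb'))
      have e1 : (fun n : ℕ => ∫ x, chi P N n x * partialP b g x * partialP b ue x * ρ x) =
          fun n : ℕ => ∫ x, chi P N n x * (partialP b g x * partialP b ue x) * ρ x :=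
        funext fun n => integral_congr_ae (Eventually.of_forall fun x => by ring)
      have e2 : ∫ x, partialP b ue x * partialP b g x * ρ x = ∫ x, partialP b g x * partialP b ue x * ρ x :=
        integral_congr_ae (Eventually.of_forall fun x => by ring)
      rw [e1, e2]; exact h
    · have h := tendsto_integral_partialP_chi_mul hω hl.le hβ γ N T b (F := fun x => g x * partialP b ue x)
        (by fun_prop : Continuous fun x => g x * partialP b ue x).aestronglyMeasurable
        (integrable_mul_mul_gibbsDensity hω hl.le hβ γ N hT hg2 (hdue2 b hb'))
      have e1 : (fun n : ℕ => ∫ x, g x * partialP b (chi P N n) x * partialP b ue x * ρ x) =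
          fun n : ℕ => ∫ x, partialP b (chi P N n) x * (g x * partialP b ue x) * ρ x :=
        funext fun n => integral_congr_ae (Eventually.of_forall fun x => by ring)
      rw [e1]; exact h
  have hlim := tendsto_nhds_unique (hLHS.congr fun n => hlevel n) hRHS
  -- `∫ uo Xg ρ` is the left-hand side
  have e : ∫ x, uo x * Xg x * ρ x = ∫ x, (u x - u (x.1, -x.2)) / 2 *
      liouvilleOp P N (fun y => P.bondCurrent N i y) (detFlow ω₂ lam β N s x) * ρ x := rfl
  rw [← e, hlim]

end Leak

end Summit.AtomisticToContinuum.FouriersLaw.Theorems.OddSectorIrreversibility.Corrector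

end
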